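import Mathlib.Analysis.SpecialFunctions.Pow.Real
import HarnessLib

/-!
# Route `UnitScaleTilt`, crux K1 «MinimiserStabilityRegPr» (stmt-QuantumFields-19200), (K2b-δ₃) storey — **NUMERICS (K2b-δ₃)-N (px12 g17): THE K-FREE `δ₃` IS LINEAR IN THE TWO KNOBS** —
# pure real arithmetic: under the quarter-budgets of px16 g13's D2 (`Θ ≥ γ∕2`, `d₁²(1+1∕ε) ≤ γ∕16`, `θ_r ≤ γ∕8`, `ε ≤ ⅛`, `r ≤ ¼`) the constant of (K2b-δ₃)-D′ ✓∕⧗`conj_resolvent_oneForm_phaseClass_kfree`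
# satisfies **`δ₃ ≤ A(γ, C_V, T)·r + B(γ)·ε₀`**, `B(γ) = 2·10⁵·γ^{−5∕2}` — so the (K2-KNIT)'s window (R_L) is inhabited by shrinking the slope `r` AND the regularity cap `ε₀`.

Cell `ym3-torus` (HUMAN RULING D-0037: SU(2) YM₃ on T³ is ladder rung R3 — NOT d = 4, NOT infinite volume, NOT a mass gap, NOT Clay).  Width seat `ym3-torus-px12` gen 17.  THEOREMS ONLY
(0 `def`, 0 `sorry`, default heartbeats); `--supports stmt-QuantumFields-19200 --as helper`, count-neutral.  HONEST LABEL: real inequalities only; nothing of any row, EX or 19200 is proved here.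

WHAT IS PROVED (ns `Summit.QuantumFields.YangMills.Theorems.Prop7Delta3Linear`): `d1_le`, `d1_sq_le`, ★★ `delta3_le_linear`.

References: T. Bałaban, CMP **99** (1985) 389–434 [Balaban1985BackgroundPropagators] ((3.46)–(3.49) pp.398–399 — the source of the K-free bookkeeping).
-/

set_option autoImplicit false

noncomputable section

namespace Summit.QuantumFields.YangMills.Theorems.Prop7Delta3Linear

/-- `√3·r·e^{r} ≤ (√3·e^{1∕4})·r` for `0 ≤ r ≤ ¼`. [folklore] -/
theorem d1_le {r : ℝ} (hr : 0 ≤ r) (hr4 : r ≤ 1 / 4) : Real.sqrt 3 * r * Real.exp r ≤ (Real.sqrt 3 * Real.exp (1 / 4)) * r := by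
  have h1 : Real.exp r ≤ Real.exp (1 / 4) := Real.exp_le_exp.mpr hr4
  have h3 : 0 ≤ Real.sqrt 3 := Real.sqrt_nonneg _
  calc Real.sqrt 3 * r * Real.exp r = (Real.sqrt 3 * Real.exp r) * r := by ring
    _ ≤ (Real.sqrt 3 * Real.exp (1 / 4)) * r := mul_le_mul_of_nonneg_right (mul_le_mul_of_nonneg_left h1 h3) hr

/-- `(√3·r·e^{r})² ≤ (3·e^{1∕2}∕4)·r` for `0 ≤ r ≤ ¼`. [folklore] -/
theorem d1_sq_le {r : ℝ} (hr : 0 ≤ r) (hr4 : r ≤ 1 / 4) : (Real.sqrt 3 * r * Real.exp r) ^ 2 ≤ (3 * Real.exp (1 / 2) / 4) * r := by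
  have e3 : Real.sqrt 3 ^ 2 = 3 := Real.sq_sqrt (by norm_num)
  have e2 : Real.exp r ^ 2 = Real.exp (2 * r) := by rw [← Real.exp_nat_mul]; norm_num
  have h1 : Real.exp (2 * r) ≤ Real.exp (1 / 2) := Real.exp_le_exp.mpr (by linarith)
  have h2 : r ^ 2 ≤ (1 / 4) * r := by nlinarith
  calc (Real.sqrt 3 * r * Real.exp r) ^ 2 = 3 * r ^ 2 * Real.exp (2 * r) := by rw [show (Real.sqrt 3 * r * Real.exp r) ^ 2 = Real.sqrt 3 ^ 2 * r ^ 2 * Real.exp r ^ 2 by ring, e3, e2]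
    _ ≤ 3 * ((1 / 4) * r) * Real.exp (1 / 2) := by gcongr
    _ = (3 * Real.exp (1 / 2) / 4) * r := by ring

/-- ★★ **THE K-FREE `δ₃` IS LINEAR IN `(r, ε₀)` UNDER THE QUARTER-BUDGETS**: with `d₁ = √3·r·e^{r}`, `θ_r = rT + 10⁵ε₀`, `c₁ = d₁²(1+1∕ε) + C_V + θ_r`,
`Θ = (1−ε)γ − εC_V − d₁²(1+1∕ε) − θ_r ≥ γ∕2`, `d₁²(1+1∕ε) ≤ γ∕16`, `θ_r ≤ γ∕8`, `0 < ε ≤ ⅛`, `0 < r ≤ ¼`: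
`(√γ)⁻¹·(d₁√(1+C_V∕γ)Θ⁻¹ + d₁(√γ)⁻¹√((Θ⁻¹ + c₁Θ⁻²)∕(1−ε)) + (d₁² + θ_r)(√γ)⁻¹Θ⁻¹) ≤ A·r + B·ε₀` with
`A = (√γ)⁻¹·(√3e^{1∕4}·√(1+C_V∕γ)·(2∕γ) + √3e^{1∕4}·(√γ)⁻¹·√((2∕γ + (γ∕4 + C_V)(2∕γ)²)∕(7∕8)) + (3e^{1∕2}∕4 + T)·(√γ)⁻¹·(2∕γ))`, `B = (√γ)⁻¹·10⁵·(√γ)⁻¹·(2∕γ)`.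
[cite: Balaban1985BackgroundPropagators, (3.46)–(3.49) pp.398–399] -/
theorem delta3_le_linear {γ CV T r ε ε₀ : ℝ} (hγ : 0 < γ) (hCV : 0 ≤ CV) (hT : 0 ≤ T) (hr : 0 < r) (hr4 : r ≤ 1 / 4)
    (hε : 0 < ε) (hε8 : ε ≤ 1 / 8) (hε₀ : 0 ≤ ε₀)
    (hbud : (Real.sqrt 3 * r * Real.exp r) ^ 2 * (1 + 1 / ε) ≤ γ / 16) (hθ8 : r * T + 10 ^ 5 * ε₀ ≤ γ / 8)
    (hΘ : γ / 2 ≤ (1 - ε) * γ - ε * CV - (Real.sqrt 3 * r * Real.exp r) ^ 2 * (1 + 1 / ε) - (r * T + 10 ^ 5 * ε₀)) :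
    (Real.sqrt γ)⁻¹ * ((Real.sqrt 3 * r * Real.exp r) * Real.sqrt (1 + CV / γ) * ((1 - ε) * γ - ε * CV - (Real.sqrt 3 * r * Real.exp r) ^ 2 * (1 + 1 / ε) - (r * T + 10 ^ 5 * ε₀))⁻¹
        + (Real.sqrt 3 * r * Real.exp r) * (Real.sqrt γ)⁻¹
            * Real.sqrt ((((1 - ε) * γ - ε * CV - (Real.sqrt 3 * r * Real.exp r) ^ 2 * (1 + 1 / ε) - (r * T + 10 ^ 5 * ε₀))⁻¹
                + ((Real.sqrt 3 * r * Real.exp r) ^ 2 * (1 + 1 / ε) + CV + (r * T + 10 ^ 5 * ε₀))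
                    * ((1 - ε) * γ - ε * CV - (Real.sqrt 3 * r * Real.exp r) ^ 2 * (1 + 1 / ε) - (r * T + 10 ^ 5 * ε₀))⁻¹ ^ 2) / (1 - ε))
        + ((Real.sqrt 3 * r * Real.exp r) ^ 2 + (r * T + 10 ^ 5 * ε₀)) * (Real.sqrt γ)⁻¹
            * ((1 - ε) * γ - ε * CV - (Real.sqrt 3 * r * Real.exp r) ^ 2 * (1 + 1 / ε) - (r * T + 10 ^ 5 * ε₀))⁻¹)
      ≤ ((Real.sqrt γ)⁻¹ * (Real.sqrt 3 * Real.exp (1 / 4) * Real.sqrt (1 + CV / γ) * (2 / γ)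
            + Real.sqrt 3 * Real.exp (1 / 4) * (Real.sqrt γ)⁻¹ * Real.sqrt ((2 / γ + (γ / 4 + CV) * (2 / γ) ^ 2) / (7 / 8))
            + (3 * Real.exp (1 / 2) / 4 + T) * (Real.sqrt γ)⁻¹ * (2 / γ))) * r
        + ((Real.sqrt γ)⁻¹ * 10 ^ 5 * (Real.sqrt γ)⁻¹ * (2 / γ)) * ε₀ := by
  -- names
  set d₁ : ℝ := Real.sqrt 3 * r * Real.exp r with hd₁
  set θr : ℝ := r * T + 10 ^ 5 * ε₀ with hθr
  set Θ : ℝ := (1 - ε) * γ - ε * CV - d₁ ^ 2 * (1 + 1 / ε) - θr with hΘdef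
  have hd₁0 : 0 ≤ d₁ := by rw [hd₁]; positivity
  have hθr0 : 0 ≤ θr := by rw [hθr]; positivity
  have hΘpos : 0 < Θ := lt_of_lt_of_le (by linarith) hΘ
  have hsγ : 0 < Real.sqrt γ := Real.sqrt_pos.mpr hγ
  -- `Θ⁻¹ ≤ 2∕γ`
  have hΘinv : Θ⁻¹ ≤ 2 / γ := by
    rw [inv_le_comm₀ hΘpos (by positivity)]
    have : (2 / γ)⁻¹ = γ / 2 := by rw [inv_div]
    rw [this]; exact hΘ
  have hΘinv0 : 0 ≤ Θ⁻¹ := inv_nonneg.mpr hΘpos.le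
  -- `d₁ ≤ √3e^{1∕4}·r`, `d₁² ≤ (3e^{1∕2}∕4)·r`
  have hd₁le : d₁ ≤ Real.sqrt 3 * Real.exp (1 / 4) * r := d1_le hr.le hr4
  have hd₁sq : d₁ ^ 2 ≤ 3 * Real.exp (1 / 2) / 4 * r := d1_sq_le hr.le hr4
  -- `c₁ ≤ γ∕4 + C_V`
  have hc₁ : d₁ ^ 2 * (1 + 1 / ε) + CV + θr ≤ γ / 4 + CV := by linarith
  have hc₁0 : 0 ≤ d₁ ^ 2 * (1 + 1 / ε) + CV + θr := by positivity
  -- the square root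
  have h1ε : 7 / 8 ≤ 1 - ε := by linarith
  have hsqrt : Real.sqrt ((Θ⁻¹ + (d₁ ^ 2 * (1 + 1 / ε) + CV + θr) * Θ⁻¹ ^ 2) / (1 - ε))
      ≤ Real.sqrt ((2 / γ + (γ / 4 + CV) * (2 / γ) ^ 2) / (7 / 8)) := by
    refine Real.sqrt_le_sqrt ?_
    have hnum : Θ⁻¹ + (d₁ ^ 2 * (1 + 1 / ε) + CV + θr) * Θ⁻¹ ^ 2 ≤ 2 / γ + (γ / 4 + CV) * (2 / γ) ^ 2 := by
      have h2 : Θ⁻¹ ^ 2 ≤ (2 / γ) ^ 2 := pow_le_pow_left₀ hΘinv0 hΘinv 2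
      have h3 : (d₁ ^ 2 * (1 + 1 / ε) + CV + θr) * Θ⁻¹ ^ 2 ≤ (γ / 4 + CV) * (2 / γ) ^ 2 :=
        mul_le_mul hc₁ h2 (sq_nonneg _) (by positivity)
      linarith
    have hnum0 : 0 ≤ Θ⁻¹ + (d₁ ^ 2 * (1 + 1 / ε) + CV + θr) * Θ⁻¹ ^ 2 := by positivity
    calc (Θ⁻¹ + (d₁ ^ 2 * (1 + 1 / ε) + CV + θr) * Θ⁻¹ ^ 2) / (1 - ε)
        ≤ (2 / γ + (γ / 4 + CV) * (2 / γ) ^ 2) / (1 - ε) := div_le_div_of_nonneg_right hnum (by linarith)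
      _ ≤ (2 / γ + (γ / 4 + CV) * (2 / γ) ^ 2) / (7 / 8) := div_le_div_of_nonneg_left (by positivity) (by norm_num) h1ε
  -- the three terms
  have t1 : d₁ * Real.sqrt (1 + CV / γ) * Θ⁻¹ ≤ (Real.sqrt 3 * Real.exp (1 / 4) * Real.sqrt (1 + CV / γ) * (2 / γ)) * r := by
    calc d₁ * Real.sqrt (1 + CV / γ) * Θ⁻¹ ≤ (Real.sqrt 3 * Real.exp (1 / 4) * r) * Real.sqrt (1 + CV / γ) * (2 / γ) :=
          mul_le_mul (mul_le_mul_of_nonneg_right hd₁le (Real.sqrt_nonneg _)) hΘinv hΘinv0 (by positivity)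
      _ = (Real.sqrt 3 * Real.exp (1 / 4) * Real.sqrt (1 + CV / γ) * (2 / γ)) * r := by ring
  have t2 : d₁ * (Real.sqrt γ)⁻¹ * Real.sqrt ((Θ⁻¹ + (d₁ ^ 2 * (1 + 1 / ε) + CV + θr) * Θ⁻¹ ^ 2) / (1 - ε))
      ≤ (Real.sqrt 3 * Real.exp (1 / 4) * (Real.sqrt γ)⁻¹ * Real.sqrt ((2 / γ + (γ / 4 + CV) * (2 / γ) ^ 2) / (7 / 8))) * r := by
    calc d₁ * (Real.sqrt γ)⁻¹ * Real.sqrt ((Θ⁻¹ + (d₁ ^ 2 * (1 + 1 / ε) + CV + θr) * Θ⁻¹ ^ 2) / (1 - ε))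
        ≤ (Real.sqrt 3 * Real.exp (1 / 4) * r) * (Real.sqrt γ)⁻¹ * Real.sqrt ((2 / γ + (γ / 4 + CV) * (2 / γ) ^ 2) / (7 / 8)) :=
          mul_le_mul (mul_le_mul_of_nonneg_right hd₁le (by positivity)) hsqrt (Real.sqrt_nonneg _) (by positivity)
      _ = (Real.sqrt 3 * Real.exp (1 / 4) * (Real.sqrt γ)⁻¹ * Real.sqrt ((2 / γ + (γ / 4 + CV) * (2 / γ) ^ 2) / (7 / 8))) * r := by ring
  have t3 : (d₁ ^ 2 + θr) * (Real.sqrt γ)⁻¹ * Θ⁻¹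
      ≤ ((3 * Real.exp (1 / 2) / 4 + T) * (Real.sqrt γ)⁻¹ * (2 / γ)) * r + (10 ^ 5 * (Real.sqrt γ)⁻¹ * (2 / γ)) * ε₀ := by
    have hsum : d₁ ^ 2 + θr ≤ (3 * Real.exp (1 / 2) / 4 + T) * r + 10 ^ 5 * ε₀ := by rw [hθr]; nlinarith [hd₁sq]
    calc (d₁ ^ 2 + θr) * (Real.sqrt γ)⁻¹ * Θ⁻¹ ≤ ((3 * Real.exp (1 / 2) / 4 + T) * r + 10 ^ 5 * ε₀) * (Real.sqrt γ)⁻¹ * (2 / γ) :=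
          mul_le_mul (mul_le_mul_of_nonneg_right hsum (by positivity)) hΘinv hΘinv0 (by positivity)
      _ = ((3 * Real.exp (1 / 2) / 4 + T) * (Real.sqrt γ)⁻¹ * (2 / γ)) * r + (10 ^ 5 * (Real.sqrt γ)⁻¹ * (2 / γ)) * ε₀ := by ring
  -- assemble
  have hsum3 := add_le_add (add_le_add t1 t2) t3
  have hsi0 : 0 ≤ (Real.sqrt γ)⁻¹ := by positivity
  have hfin := mul_le_mul_of_nonneg_left hsum3 hsi0
  refine hfin.trans (le_of_eq ?_)
  ring

end Summit.QuantumFields.YangMills.Theorems.Prop7Delta3Linear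

end
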